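import Summits.Parity.GeneralizedHardyLittlewood.Theorems.LeeYangFibresRelativeDimOneNecessityDefs
import Summits.Parity.GeneralizedHardyLittlewood.Theorems.PairsToGHL.Negative.ShiftPairDictionary
import Literature.NumberTheory.Sieve.SingularSeriesMultiplesMean
import Literature.NumberTheory.LFunctions.RHWave0PNTProofs
import HarnessLib

/-!
# Route `LeeYangFibres`, crux `RelativeDimOne` (stmt-Parity-14113), line `SketchIdeator1`:
# certificate A1 `latticeNecessity : UpperRelativeDimOne → SharpClassSecondMoment`

Card `gallagher-backwards-split`, read BACKWARDS. Gallagher's identity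
`∑_{a mod q} ψ(N;q,a)² = ∑_{n ≤ N} Λ(n)² + 2 ∑_{k ≥ 1} S_N(qk)`, `S_N(h) = ∑_{1 ≤ n ≤ N-h} Λ(n)Λ(n+h)`
(`gallagher_identity`, exact finite combinatorics), turns UPPER bounds for the pair sums `S_N(qk)`
into an upper bound for the second moment of primes in residue classes to ANY modulus `q ≤ N`:

* the pair sum `S_N(h)` is the Green–Tao weighted sum of the shift pair `(n, n + h)`
  (`shiftPairSystem h`, `t = 2`, `d = 1`, `‖·‖_N ≤ 3`) over the convex body `[-(N-h), N-h]`, whose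
  archimedean factor is `N - h` and whose singular product is the Goldbach singular series `𝔖(h)`
  (tree dictionary `Theorems/PairsToGHL/Negative/ShiftPairDictionary`, completed here for odd `h`,
  where both sides vanish); so the upper half of the crux gives
  `S_N(h) ≤ (1+ε)(N-h)𝔖(h) + εN` for `1 ≤ h ≤ N`, `N ≥ N₀(ε)` (`pairSum_le`);
* the lattice mean of the singular series is bounded EXACTLY in the tree,
  `∑_{k ≤ K} 𝔖(qk) ≤ (q/φ(q)) K` (`sum_goldbachSingularSeries_mul_le`, Goldston–Suriajaya Lemma 1),
  and Abel summation against the decreasing weight `N - qk` gives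
  `∑_{qk ≤ N} (N - qk)𝔖(qk) ≤ N²/(2φ(q))` (`sum_linearWeight_le_of_partial_le`);
* the diagonal is `∑_{n ≤ N} Λ(n)² ≤ ψ(N) log N ≤ (1+ε) N log N` by the prime number theorem
  (`vonMangoldt_summatory_sub_isLittleO`, tree).

Hence `∑_{a mod q} ψ(N;q,a)² ≤ (1+ε)(N²/φ(q) + N log N)` for all `1 ≤ q ≤ N`, `N ≥ N₀(ε)`:
the statement `SharpClassSecondMoment` (individual-modulus Barban–Davenport–Halberstam with
constant `1`, a consequence of GRH that is open unconditionally).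

References: Gallagher, Mathematika 23 (1976); Friedlander–Goldston, Quart. J. Math. 47 (1996) Prop. 1;
Goldston–Suriajaya (2021) Lemma 1 and §7; Green–Tao (2010) Example 1.
-/

noncomputable section

open scoped BigOperators Classical Topology ArithmeticFunction.vonMangoldt
open Finset Filter Literature.NumberTheory.Sieve
open Summit.Parity.GeneralizedHardyLittlewood.Theorems.PairsToGHL.Negative

namespace Summit.Parity.GeneralizedHardyLittlewood.Cruxes.RelativeDimOne.GallagherBackwards

/-! ### Gallagher's identity -/

/-- Reindexing `m = n + qk` (`1 ≤ k ≤ N/q`) of the integers `n < m ≤ N` with `m ≡ n (mod q)`. -/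
theorem sum_filter_congruent_above (N q n : ℕ) (hq : 0 < q) (f : ℕ → ℝ) :
    ∑ m ∈ (Icc 1 N).filter (fun m => n < m ∧ m % q = n % q), f m =
      ∑ k ∈ (Icc 1 (N / q)).filter (fun k => n + q * k ≤ N), f (n + q * k) := by
  symm
  refine Finset.sum_nbij' (fun k => n + q * k) (fun m => (m - n) / q) (fun k hk => ?_)
    (fun m hm => ?_) (fun k hk => ?_) (fun m hm => ?_) (fun k _ => rfl)
  · simp only [mem_filter, mem_Icc] at hk ⊢
    obtain ⟨⟨hk1, -⟩, hkN⟩ := hk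
    have hqk : 1 ≤ q * k := Nat.one_le_iff_ne_zero.mpr (Nat.mul_ne_zero hq.ne' (by omega))
    exact ⟨⟨by omega, hkN⟩, by omega, Nat.add_mul_mod_self_left n q k⟩
  · simp only [mem_filter, mem_Icc] at hm ⊢
    obtain ⟨⟨-, hmN⟩, hnm, hmod⟩ := hm
    have hdvd : q ∣ m - n := Nat.dvd_of_mod_eq_zero (Nat.sub_mod_eq_zero_of_mod_eq hmod)
    have hmul : q * ((m - n) / q) = m - n := Nat.mul_div_cancel' hdvd
    have hqle : q ≤ m - n := Nat.le_of_dvd (by omega) hdvd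
    refine ⟨⟨?_, Nat.div_le_div_right (by omega)⟩, by omega⟩
    exact (Nat.le_div_iff_mul_le hq).mpr (by simpa using hqle)
  · rw [Nat.add_sub_cancel_left, Nat.mul_div_cancel_left _ hq]
  · simp only [mem_filter, mem_Icc] at hm
    obtain ⟨-, hnm, hmod⟩ := hm
    have hdvd : q ∣ m - n := Nat.dvd_of_mod_eq_zero (Nat.sub_mod_eq_zero_of_mod_eq hmod)
    rw [Nat.mul_div_cancel' hdvd]
    omega

/-- **Gallagher's identity** `∑_{a mod q} ψ(N;q,a)² = ∑_{n ≤ N} Λ(n)² + 2 ∑_{1 ≤ k ≤ N/q} S_N(qk)` with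
`S_N(h) = ∑_{1 ≤ n ≤ N-h} Λ(n)Λ(n+h)`: expand the squares into pairs `n ≡ m (mod q)` in `[1, N]²`,
split `m = n` / `n < m` / `m < n`, identify the two off-diagonal parts by symmetry and write
`m = n + qk`. -/
theorem gallagher_identity (N q : ℕ) (hq : 0 < q) :
    ∑ a ∈ range q, classPsi N q a ^ 2 =
      ∑ n ∈ Icc 1 N, Λ n ^ 2 +
        2 * ∑ k ∈ Icc 1 (N / q), ∑ n ∈ Icc 1 (N - q * k), Λ n * Λ (n + q * k) := by
  -- expand the squares and collect the pairs by their first coordinate `n`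
  have h1 : ∑ a ∈ range q, classPsi N q a ^ 2 =
      ∑ n ∈ Icc 1 N, Λ n * ∑ m ∈ (Icc 1 N).filter (fun m => m % q = n % q), Λ m := by
    have hmaps : ∀ n ∈ Icc 1 N, n % q ∈ range q := fun n _ => mem_range.mpr (Nat.mod_lt n hq)
    rw [← Finset.sum_fiberwise_of_maps_to hmaps]
    refine Finset.sum_congr rfl fun a _ => ?_
    rw [classPsi, sq, Finset.sum_mul]
    refine Finset.sum_congr rfl fun n hn => ?_
    rw [(mem_filter.mp hn).2]
  -- split `m = n`, `n < m`, `m < n`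
  set P : ℕ → ℕ → ℝ := fun n m => if m % q = n % q then Λ n * Λ m else 0 with hP
  have h2 : ∀ n ∈ Icc 1 N, Λ n * ∑ m ∈ (Icc 1 N).filter (fun m => m % q = n % q), Λ m =
      Λ n ^ 2 + (∑ m ∈ Icc 1 N, (if n < m then P n m else 0)) +
        ∑ m ∈ Icc 1 N, (if m < n then P n m else 0) := by
    intro n hn
    rw [Finset.mul_sum, Finset.sum_filter]
    have hpt : ∀ m ∈ Icc 1 N, (if m % q = n % q then Λ n * Λ m else 0) =
        (if m = n then Λ n ^ 2 else 0) + (if n < m then P n m else 0) +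
          (if m < n then P n m else 0) := by
      intro m _
      rcases lt_trichotomy m n with hlt | rfl | hgt
      · simp [hP, hlt, hlt.ne, not_lt_of_gt hlt]
      · simp [sq]
      · simp [hP, hgt, hgt.ne', not_lt_of_gt hgt]
    rw [Finset.sum_congr rfl hpt, Finset.sum_add_distrib, Finset.sum_add_distrib,
      Finset.sum_ite_eq' (Icc 1 N) n, if_pos hn]
  -- the two off-diagonal parts agree
  have h3 : ∑ n ∈ Icc 1 N, ∑ m ∈ Icc 1 N, (if m < n then P n m else 0) =
      ∑ n ∈ Icc 1 N, ∑ m ∈ Icc 1 N, (if n < m then P n m else 0) := by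
    rw [Finset.sum_comm]
    refine Finset.sum_congr rfl fun n _ => Finset.sum_congr rfl fun m _ => ?_
    by_cases hnm : n < m
    · simp only [if_pos hnm, hP]
      by_cases hmod : n % q = m % q
      · rw [if_pos hmod, if_pos hmod.symm, mul_comm]
      · rw [if_neg hmod, if_neg (Ne.symm hmod)]
    · rw [if_neg hnm, if_neg hnm]
  -- reindex the upper part by `m = n + qk` and swap the summations
  have h4 : ∑ n ∈ Icc 1 N, ∑ m ∈ Icc 1 N, (if n < m then P n m else 0) =
      ∑ k ∈ Icc 1 (N / q), ∑ n ∈ Icc 1 (N - q * k), Λ n * Λ (n + q * k) := by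
    have hR : ∀ k ∈ Icc 1 (N / q), ∑ n ∈ Icc 1 (N - q * k), Λ n * Λ (n + q * k) =
        ∑ n ∈ Icc 1 N, if n + q * k ≤ N then Λ n * Λ (n + q * k) else 0 := by
      intro k _
      rw [← Finset.sum_filter]
      refine Finset.sum_congr ?_ fun _ _ => rfl
      ext n
      simp only [mem_Icc, mem_filter]
      omega
    rw [Finset.sum_congr rfl hR]
    conv_rhs => rw [Finset.sum_comm]
    refine Finset.sum_congr rfl fun n _ => ?_
    have hL : ∑ m ∈ Icc 1 N, (if n < m then P n m else 0) =
        ∑ m ∈ (Icc 1 N).filter (fun m => n < m ∧ m % q = n % q), Λ n * Λ m := by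
      rw [Finset.sum_filter]
      refine Finset.sum_congr rfl fun m _ => ?_
      by_cases hnm : n < m
      · by_cases hmod : m % q = n % q
        · simp [hP, hnm, hmod]
        · simp [hP, hnm, hmod]
      · simp [hnm]
    rw [hL, sum_filter_congruent_above N q n hq (fun m => Λ n * Λ m), Finset.sum_filter]
  rw [h1, Finset.sum_congr rfl h2, Finset.sum_add_distrib, Finset.sum_add_distrib, h3, h4]
  ring

/-! ### The pair sums `S_N(h)` in the Green–Tao dictionary -/

/-- The weighted sum over the sub-box `[-M, M]^d ⊆ [-N, N]^d` does not see the ambient scale. -/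
theorem vonMangoldtSum_realBox_of_le {d t : ℕ} (Ψ : Fin t → AffLinForm d) {M N : ℕ}
    (hMN : M ≤ N) : vonMangoldtSum Ψ (realBox d M) N = vonMangoldtSum Ψ (realBox d M) M := by
  unfold vonMangoldtSum
  refine Finset.sum_congr ?_ fun _ _ => rfl
  ext n
  simp only [Finset.mem_filter, latticeBox, Fintype.mem_piFinset, Finset.mem_Icc, realBox,
    Set.mem_Icc, Pi.le_def, realPoint]
  constructor
  · rintro ⟨-, h1, h2⟩
    refine ⟨fun j => ⟨?_, ?_⟩, h1, h2⟩
    · have := h1 j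
      exact_mod_cast this
    · have := h2 j
      exact_mod_cast this
  · rintro ⟨-, h1, h2⟩
    refine ⟨fun j => ⟨?_, ?_⟩, h1, h2⟩
    · have h1j : -(M : ℤ) ≤ n j := by
        have := h1 j
        exact_mod_cast this
      omega
    · have := h2 j
      have : (n j : ℝ) ≤ (N : ℝ) := this.trans (by exact_mod_cast hMN)
      exact_mod_cast this

/-- For an odd shift `h` the singular product of `(n, n + h)` vanishes: `β₂ = 0` kills every partial
product from `x = 2` on, and the partial products converge (Green–Tao Lemma 1.3, tree). -/
theorem singularProduct_shiftPairSystem_of_odd {h : ℕ} (hh : Odd h) :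
    singularProduct (shiftPairSystem (h : ℤ)) = 0 := by
  have h0 : h ≠ 0 := fun h0 => by simp [h0] at hh
  have hnd : IsNondegenerateSystem (shiftPairSystem (h : ℤ)) :=
    isNondegenerateSystem_shiftPairSystem_iff.mpr (by exact_mod_cast h0)
  have h1 : Tendsto (singularProductPartial (shiftPairSystem (h : ℤ))) atTop
      (𝓝 (singularProduct (shiftPairSystem (h : ℤ)))) :=
    tendsto_singularProductPartial_holds 1 2 _ hnd
  have h2dvd : ¬ 2 ∣ h := fun hd => (Nat.not_even_iff_odd.mpr hh) (even_iff_two_dvd.mpr hd)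
  have hβ : localFactor (shiftPairSystem (h : ℤ)) 2 = 0 := by
    rw [localFactor_shiftPairSystem_of_not_dvd Nat.prime_two h2dvd]
    norm_num
  have h2 : Tendsto (singularProductPartial (shiftPairSystem (h : ℤ))) atTop (𝓝 0) := by
    refine tendsto_const_nhds.congr' ?_
    rw [EventuallyEq, eventually_atTop]
    refine ⟨2, fun x hx => ?_⟩
    rw [singularProductPartial,
      Finset.prod_eq_zero (Nat.mem_primesLE.mpr ⟨hx, Nat.prime_two⟩) hβ]
  exact tendsto_nhds_unique h1 h2

/-- `∏_p β_p(n, n + h) = 𝔖(h)` for every shift `h ≥ 1` (even `h`: tree; odd `h`: both sides vanish). -/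
theorem singularProduct_shiftPairSystem_eq {h : ℕ} (h0 : h ≠ 0) :
    singularProduct (shiftPairSystem (h : ℤ)) = goldbachSingularSeries h := by
  rcases Nat.even_or_odd h with hh | hh
  · exact singularProduct_shiftPairSystem hh h0
  · rw [singularProduct_shiftPairSystem_of_odd hh, goldbachSingularSeries, if_pos hh]

/-- The pair sums under the upper half of the crux at `t = 2`, `L = 3`: the shift pair `(n, n + h)`
over the body `[-(N-h), N-h] ⊆ [-N, N]` has weighted sum `S_N(h) = ∑_{n ≤ N-h} Λ(n)Λ(n+h)`,
archimedean factor `N - h` and singular product `𝔖(h)`, so `S_N(h) ≤ (1+ε)(N-h)𝔖(h) + εN` for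
`1 ≤ h ≤ N`, `N ≥ N₁`. -/
theorem pairSum_le {ε : ℝ} {N₁ : ℕ}
    (hN₁ : ∀ N : ℕ, N₁ ≤ N → ∀ Ψ : Fin 2 → AffLinForm 1, IsNondegenerateSystem Ψ →
      affLinSize Ψ N ≤ ((3 : ℕ) : ℝ) → ∀ K : Set (Fin 1 → ℝ), Convex ℝ K →
        K ⊆ realBox 1 N →
          vonMangoldtSum Ψ K N ≤ (1 + ε) * (archFactor Ψ K * singularProduct Ψ) + ε * N)
    {N : ℕ} (hN : N₁ ≤ N) {h : ℕ} (h1 : 1 ≤ h) (hhN : h ≤ N) :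
    ∑ n ∈ Icc 1 (N - h), Λ n * Λ (n + h) ≤
      (1 + ε) * (((N - h : ℕ) : ℝ) * goldbachSingularSeries h) + ε * N := by
  have hN0 : 0 < N := by omega
  have hnd : IsNondegenerateSystem (shiftPairSystem (h : ℤ)) :=
    isNondegenerateSystem_shiftPairSystem_iff.mpr (by exact_mod_cast (show h ≠ 0 by omega))
  have hsize : affLinSize (shiftPairSystem (h : ℤ)) (N : ℝ) ≤ ((3 : ℕ) : ℝ) := by
    simpa using affLinSize_shiftPairSystem_le hN0 hhN
  have hconv : Convex ℝ (realBox 1 ((N - h : ℕ) : ℝ)) := convex_Icc _ _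
  have hsub : realBox 1 ((N - h : ℕ) : ℝ) ⊆ realBox 1 (N : ℝ) := by
    have hle : ((N - h : ℕ) : ℝ) ≤ N := by exact_mod_cast Nat.sub_le N h
    exact Set.Icc_subset_Icc (fun _ => neg_le_neg hle) (fun _ => hle)
  have := hN₁ N hN (shiftPairSystem (h : ℤ)) hnd hsize _ hconv hsub
  rwa [vonMangoldtSum_realBox_of_le _ (Nat.sub_le N h), vonMangoldtSum_shiftPairSystem,
    archFactor_shiftPairSystem, singularProduct_shiftPairSystem_eq (by omega)] at this

/-! ### Abel summation against the tree's lattice mean of `𝔖` -/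

/-- Gauss: `∑_{j < K} j = K(K-1)/2` in `ℝ`. -/
theorem sum_range_cast_eq_mul_pred_div_two (K : ℕ) :
    ∑ j ∈ range K, (j : ℝ) = (K : ℝ) * ((K : ℝ) - 1) / 2 := by
  induction K with
  | zero => simp
  | succ K ih =>
    rw [Finset.sum_range_succ, ih]
    push_cast
    ring

/-- Abel summation: `∑_{k ≤ K} (N - qk) s_k = (N - qK) A_K + q ∑_{j < K} A_j` with
`A_j = ∑_{1 ≤ k ≤ j} s_k`. -/
theorem sum_linearWeight_eq_abel (N q : ℝ) (s : ℕ → ℝ) (K : ℕ) :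
    ∑ k ∈ Icc 1 K, (N - q * k) * s k =
      (N - q * K) * ∑ k ∈ Icc 1 K, s k + q * ∑ j ∈ range K, ∑ k ∈ Icc 1 j, s k := by
  induction K with
  | zero => simp
  | succ K ih =>
    rw [Finset.sum_Icc_succ_top (by omega), ih, Finset.sum_Icc_succ_top (by omega),
      Finset.sum_range_succ]
    push_cast
    ring

/-- The Fejér-weighted lattice mean: if `A_j ≤ c j` for all `j` (`c ≥ 0`) then
`∑_{1 ≤ k ≤ K} (N - qk) s_k ≤ c N²/(2q)` whenever `qK ≤ N`
(`= c[(N - qK)K + qK(K-1)/2] ≤ c N²/(2q)` since `(N - qK)² + q²K ≥ 0`). -/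
theorem sum_linearWeight_le_of_partial_le {N q c : ℝ} (hq : 0 < q) (hc : 0 ≤ c)
    {s : ℕ → ℝ} (hs : ∀ j : ℕ, ∑ k ∈ Icc 1 j, s k ≤ c * j) {K : ℕ}
    (hK : q * K ≤ N) :
    ∑ k ∈ Icc 1 K, (N - q * k) * s k ≤ c * N ^ 2 / (2 * q) := by
  rw [sum_linearWeight_eq_abel]
  have h1 : (N - q * K) * ∑ k ∈ Icc 1 K, s k ≤ (N - q * K) * (c * K) :=
    mul_le_mul_of_nonneg_left (hs K) (by linarith)
  have h2 : q * ∑ j ∈ range K, ∑ k ∈ Icc 1 j, s k ≤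
      q * (c * ((K : ℝ) * ((K : ℝ) - 1) / 2)) := by
    refine mul_le_mul_of_nonneg_left ?_ hq.le
    calc ∑ j ∈ range K, ∑ k ∈ Icc 1 j, s k ≤ ∑ j ∈ range K, c * (j : ℝ) :=
          Finset.sum_le_sum fun j _ => hs j
      _ = c * ((K : ℝ) * ((K : ℝ) - 1) / 2) := by
          rw [← Finset.mul_sum, sum_range_cast_eq_mul_pred_div_two]
  have h3 : (N - q * K) * (c * K) + q * (c * ((K : ℝ) * ((K : ℝ) - 1) / 2)) ≤
      c * N ^ 2 / (2 * q) := by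
    rw [le_div_iff₀ (by positivity)]
    have hK0 : (0 : ℝ) ≤ K := Nat.cast_nonneg K
    nlinarith [sq_nonneg (N - q * K), mul_nonneg hc hK0, mul_nonneg (mul_nonneg hc hK0) hq.le,
      mul_nonneg hc (sq_nonneg (N - q * K))]
  linarith

/-! ### The diagonal: prime number theorem -/

/-- PNT in the form `ψ(N) = ∑_{n ≤ N} Λ(n) ≤ (1+ε)N` for `N ≥ N₀(ε)` (Wiener–Ikehara, tree). -/
theorem exists_vonMangoldt_sum_le_of_pnt {ε : ℝ} (hε : 0 < ε) :
    ∃ N₀ : ℕ, ∀ N : ℕ, N₀ ≤ N → ∑ n ∈ Icc 1 N, Λ n ≤ (1 + ε) * N := by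
  have h := (Literature.NumberTheory.LFunctions.vonMangoldt_summatory_sub_isLittleO.def hε)
  rw [eventually_atTop] at h
  obtain ⟨N₀, hN₀⟩ := h
  refine ⟨N₀, fun N hN => ?_⟩
  have h1 := hN₀ N hN
  rw [Real.norm_eq_abs, Real.norm_of_nonneg (Nat.cast_nonneg N)] at h1
  have h2 := (abs_le.mp h1).2
  linarith

/-- The diagonal: `∑_{n ≤ N} Λ(n)² ≤ log N · ψ(N)` (`0 ≤ Λ(n) ≤ log n ≤ log N`). -/
theorem sum_vonMangoldt_sq_le_log_mul (N : ℕ) :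
    ∑ n ∈ Icc 1 N, Λ n ^ 2 ≤ Real.log N * ∑ n ∈ Icc 1 N, Λ n := by
  rw [Finset.mul_sum]
  refine Finset.sum_le_sum fun n hn => ?_
  obtain ⟨hn1, hnN⟩ := mem_Icc.mp hn
  rw [sq]
  refine mul_le_mul_of_nonneg_right ?_ ArithmeticFunction.vonMangoldt_nonneg
  refine ArithmeticFunction.vonMangoldt_le_log.trans ?_
  exact Real.log_le_log (by exact_mod_cast hn1) (by exact_mod_cast hnN)

/-! ### Assembly -/

/-- **Certificate A1 of card `gallagher-backwards-split`**: the UPPER half of the crux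
`RelativeDimOne` (at `t = 2`, `L = 3` only: shift pairs `(n, n + qk)` on the bodies `[-(N-qk), N-qk]`)
implies the sharp second moment `∑_{a mod q} ψ(N;q,a)² ≤ (1+ε)(N²/φ(q) + N log N)` for EVERY
modulus `1 ≤ q ≤ N`, `N ≥ N₀(ε)`. Gallagher's identity + `pairSum_le` + the tree's exact lattice mean
`∑_{k ≤ K} 𝔖(qk) ≤ (q/φ(q))K` with Abel summation (`∑_{qk ≤ N}(N - qk)𝔖(qk) ≤ N²/(2φ(q))`) + PNT on the
diagonal; the `εN` slack of the crux costs `2 · (N/q) · εN ≤ 2εN²/φ(q)`. -/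
theorem latticeNecessity : UpperRelativeDimOne → SharpClassSecondMoment := by
  intro h ε hε
  have hε₁ : 0 < ε / 4 := by positivity
  obtain ⟨N₁, hN₁⟩ := h 2 3 (by norm_num) (ε / 4) hε₁
  obtain ⟨N₂, hN₂⟩ := exists_vonMangoldt_sum_le_of_pnt hε₁
  refine ⟨max N₁ N₂ + 1, fun N hN q hq hqN => ?_⟩
  have hN1 : N₁ ≤ N := by omega
  have hN2 : N₂ ≤ N := by omega
  have hNpos : 0 < N := by omega
  have hq0 : 0 < q := hq
  have hqR : (0 : ℝ) < q := by exact_mod_cast hq0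
  have hφ0 : (0 : ℝ) < Nat.totient q := by exact_mod_cast Nat.totient_pos.mpr hq0
  have hφq : (Nat.totient q : ℝ) ≤ q := by exact_mod_cast Nat.totient_le q
  set K := N / q with hK
  have hqK : q * K ≤ N := Nat.mul_div_le N q
  rw [gallagher_identity N q hq0]
  -- the diagonal
  have hlog : 0 ≤ Real.log N := Real.log_nonneg (by exact_mod_cast hNpos)
  have hdiag : ∑ n ∈ Icc 1 N, Λ n ^ 2 ≤ (1 + ε / 4) * (N * Real.log N) := by
    calc ∑ n ∈ Icc 1 N, Λ n ^ 2
        ≤ Real.log N * ∑ n ∈ Icc 1 N, Λ n := sum_vonMangoldt_sq_le_log_mul N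
      _ ≤ Real.log N * ((1 + ε / 4) * N) := mul_le_mul_of_nonneg_left (hN₂ N hN2) hlog
      _ = (1 + ε / 4) * (N * Real.log N) := by ring
  -- the pair sums
  have hpair : ∀ k ∈ Icc 1 K, ∑ n ∈ Icc 1 (N - q * k), Λ n * Λ (n + q * k) ≤
      (1 + ε / 4) * (((N : ℝ) - q * k) * goldbachSingularSeries (q * k)) + ε / 4 * N := by
    intro k hk
    obtain ⟨hk1, hkK⟩ := mem_Icc.mp hk
    have hqk : q * k ≤ N := (Nat.mul_le_mul_left q hkK).trans hqK
    have h1qk : 1 ≤ q * k := Nat.one_le_iff_ne_zero.mpr (Nat.mul_ne_zero hq0.ne' (by omega))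
    have := pairSum_le hN₁ hN1 h1qk hqk
    have hcast : ((N - q * k : ℕ) : ℝ) = (N : ℝ) - q * k := by
      rw [Nat.cast_sub hqk, Nat.cast_mul]
    rwa [hcast] at this
  have hmean : ∀ j : ℕ, ∑ k ∈ Icc 1 j, goldbachSingularSeries (q * k) ≤
      (q : ℝ) / (Nat.totient q : ℝ) * j := fun j => by
    rw [show Icc 1 j = Ioc 0 j from Finset.Icc_succ_left_eq_Ioc 0 j]
    exact SingularSeriesMean.sum_goldbachSingularSeries_mul_le hq0.ne' j
  have hsum : ∑ k ∈ Icc 1 K, ∑ n ∈ Icc 1 (N - q * k), Λ n * Λ (n + q * k) ≤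
      (1 + ε / 4) * ((N : ℝ) ^ 2 / Nat.totient q / 2) + ε / 4 * ((N : ℝ) ^ 2 / q) := by
    calc ∑ k ∈ Icc 1 K, ∑ n ∈ Icc 1 (N - q * k), Λ n * Λ (n + q * k)
        ≤ ∑ k ∈ Icc 1 K,
            ((1 + ε / 4) * (((N : ℝ) - q * k) * goldbachSingularSeries (q * k)) + ε / 4 * N) :=
          Finset.sum_le_sum hpair
      _ = (1 + ε / 4) * ∑ k ∈ Icc 1 K, ((N : ℝ) - q * k) * goldbachSingularSeries (q * k) +
            ε / 4 * N * K := by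
          rw [Finset.sum_add_distrib, ← Finset.mul_sum, Finset.sum_const, Nat.card_Icc,
            Nat.add_sub_cancel, nsmul_eq_mul]
          ring
      _ ≤ (1 + ε / 4) * ((q : ℝ) / (Nat.totient q : ℝ) * (N : ℝ) ^ 2 / (2 * q)) +
            ε / 4 * N * ((N : ℝ) / q) := by
          gcongr (1 + ε / 4) * ?_ + ε / 4 * N * ?_
          · exact sum_linearWeight_le_of_partial_le (s := fun k => goldbachSingularSeries (q * k))
              hqR (by positivity) hmean (by exact_mod_cast hqK)
          · exact Nat.cast_div_le
      _ = (1 + ε / 4) * ((N : ℝ) ^ 2 / Nat.totient q / 2) + ε / 4 * ((N : ℝ) ^ 2 / q) := by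
          field_simp
  -- assembly
  have hX : (0 : ℝ) ≤ (N : ℝ) ^ 2 / Nat.totient q := by positivity
  have hY : (0 : ℝ) ≤ (N : ℝ) * Real.log N := by positivity
  have hZ : ε / 4 * ((N : ℝ) ^ 2 / q) ≤ ε / 4 * ((N : ℝ) ^ 2 / Nat.totient q) :=
    mul_le_mul_of_nonneg_left (div_le_div_of_nonneg_left (by positivity) hφ0 hφq) hε₁.le
  have hεX : 0 ≤ ε * ((N : ℝ) ^ 2 / Nat.totient q) := mul_nonneg hε.le hX
  have hεY : 0 ≤ ε * ((N : ℝ) * Real.log N) := mul_nonneg hε.le hY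
  linarith

end Summit.Parity.GeneralizedHardyLittlewood.Cruxes.RelativeDimOne.GallagherBackwards

end
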